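import Literature.Analysis.OperatorTheory.FiniteRankCapacitance
import Mathlib.Analysis.SpecificLimits.Normed
import HarnessLib

/-!
# Inverting `1 − S∘P` on a Banach space when `S∘P` is «finite rank + small in a second norm», with the constant

`Literature/Analysis/OperatorTheory`; proofs-layer file (theorems only; no definitions, no named facts), in the vocabulary of
`FiniteRankCapacitance.lean` (`finiteRank`, `capMatrix`, `capInverse`).

SETTING.  `E` a real Banach space, `W` a real normed space, `S : W →L E` (a «solution operator») and `P : E →L W` (a «perturbation»).
The perturbation splits as a FINITE-RANK part `Π_N u = ∑ᵢ ℓᵢ(u) fᵢ` (`fᵢ ∈ W`, `ℓᵢ ∈ E*`) plus a remainder that is SMALL as a map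
`E → W`: `‖P u − ∑ᵢ ℓᵢ(u) fᵢ‖_W ≤ ε‖u‖_E`.  Then `S∘Π_N = finiteRank (S∘f) ℓ` is finite rank on `E`, its capacitance matrix is
`Cⱼᵢ = ℓⱼ(S fᵢ)` («`N` forward solves»), and a two-sided inverse `N` of `1 − C` gives the two-sided inverse
`T_N := capInverse (S∘f) ℓ N` of `D_N := 1 − S∘Π_N` (Sherman–Morrison–Woodbury, `FiniteRankCapacitance`).  If moreover
`‖T_N (S g)‖_E ≤ K_w‖g‖_W` (the «`w → E`» constant of the finite-rank-corrected inverse) and `K_w·ε < 1`, the Banach lemma run in `E`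
on `X := T_N∘S∘Π_T`, `‖X‖ ≤ K_w ε`, inverts `1 − S∘P = D_N∘(1 − X)`:

**`exists_twoSided_inverse_one_sub_comp`**: there is `M : E →L E` with `M∘(1 − S∘P) = 1 = (1 − S∘P)∘M` and
`‖M (S g)‖_E ≤ K_w/(1 − K_w ε)·‖g‖_W` [cite: Kato1966, IV-§1.4, Thm. 1.16] (stability of bounded invertibility under small
perturbations) with [cite: Kato1966, III-§4.3, (4.13)] (degenerate perturbations via the capacitance matrix).

This is the two-norm Neumann step of `CoerciveFiniteRankInverse.exists_inverse_sub_of_two_norm` reorganised around the operator `1 − S∘P`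
on `E` (no bounded «`B : E → E*`» is needed — the form whose solution operator is `S` may be unbounded).  MOTIVATION (provenance only):
step (C2)+(C3) of an a-posteriori existence proof in which `DG(x̄)⁻¹ = M∘S`, `S` the solution operator of a coercive local part and `P` a
nonlocal perturbation (cell ns-blowup, zone Z3, case Z3-SR-CERT; `K_w = K_Nw`, `ε = ε_N`).  WHAT THIS IS NOT: nothing about any particular
operator; abstract functional analysis.

## References
* [Kato1966] T. Kato, *Perturbation Theory for Linear Operators*, Springer 1966, III-§4.3 (4.13), IV-§1.4 Thm. 1.16.
-/

noncomputable section

open Matrix Finset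
open scoped BigOperators

namespace Literature.Analysis.OperatorTheory

variable {E W : Type*} [NormedAddCommGroup E] [NormedSpace ℝ E] [NormedAddCommGroup W] [NormedSpace ℝ W]
variable {ι : Type*} [Fintype ι] [DecidableEq ι]

omit [DecidableEq ι] in
/-- `S` applied to the finite-rank part of `P` is the finite-rank operator with vectors `S fᵢ`:
`S (∑ᵢ ℓᵢ(u) fᵢ) = finiteRank (S∘f) ℓ u`. [cite: Kato1966, III-§4.3, (4.7)] -/
theorem map_sum_smul_eq_finiteRank (S : W →L[ℝ] E) (f : ι → W) (ℓ : ι → E →L[ℝ] ℝ) (u : E) :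
    S (∑ i, ℓ i u • f i) = finiteRank (fun i => S (f i)) ℓ u := by
  rw [finiteRank_apply, map_sum]
  simp only [map_smul]

/-- `‖(1 − X)⁻¹‖ ≤ (1 − ‖X‖)⁻¹` for `‖X‖ < 1` (geometric series, `‖1‖ ≤ 1`). [cite: Kato1966, IV-§1.4, Thm. 1.16] -/
theorem norm_inv_oneSub_le [CompleteSpace E] {X : E →L[ℝ] E} (hX : ‖X‖ < 1) :
    ‖(↑(Units.oneSub X hX)⁻¹ : E →L[ℝ] E)‖ ≤ (1 - ‖X‖)⁻¹ := by
  have h1 : (↑(Units.oneSub X hX)⁻¹ : E →L[ℝ] E) = ∑' n : ℕ, X ^ n := rfl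
  rw [h1]
  have h2 := tsum_geometric_le_of_norm_lt_one X hX
  have h3 : ‖(1 : E →L[ℝ] E)‖ ≤ 1 := ContinuousLinearMap.norm_id_le
  linarith

/-- **Two-sided inverse of `1 − S∘P` from «finite rank + two-norm small», with the constant.**  Let `S : W →L E`, `P : E →L W`
(`E` Banach), `fᵢ ∈ W`, `ℓᵢ ∈ E*` (`i` in a finite type), `N` a two-sided inverse of `1 − C`, `Cⱼᵢ = ℓⱼ(S fᵢ)`; suppose
`‖capInverse (S∘f) ℓ N (S g)‖ ≤ K_w‖g‖` for all `g ∈ W`, `‖P u − ∑ᵢ ℓᵢ(u) fᵢ‖ ≤ ε‖u‖` for all `u ∈ E`, `K_w, ε ≥ 0`, `K_w ε < 1`.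
Then there is `M : E →L E` with `M x − S (P (M x)) = x` and `M (x − S (P x)) = x` for all `x` (a two-sided inverse of `1 − S∘P`) and
`‖M (S g)‖ ≤ K_w/(1 − K_w ε)·‖g‖`. [cite: Kato1966, IV-§1.4, Thm. 1.16] -/
theorem exists_twoSided_inverse_one_sub_comp [CompleteSpace E] (S : W →L[ℝ] E) (P : E →L[ℝ] W) (f : ι → W) (ℓ : ι → E →L[ℝ] ℝ)
    (N : Matrix ι ι ℝ) (hN₁ : (1 - capMatrix (fun i => S (f i)) ℓ) * N = 1) (hN₂ : N * (1 - capMatrix (fun i => S (f i)) ℓ) = 1)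
    {Kw ε : ℝ} (hKw0 : 0 ≤ Kw) (hε0 : 0 ≤ ε)
    (hKw : ∀ g : W, ‖capInverse (fun i => S (f i)) ℓ N (S g)‖ ≤ Kw * ‖g‖)
    (hε : ∀ u : E, ‖P u - ∑ i, ℓ i u • f i‖ ≤ ε * ‖u‖) (h1 : Kw * ε < 1) :
    ∃ M : E →L[ℝ] E, (∀ x, M x - S (P (M x)) = x) ∧ (∀ x, M (x - S (P x)) = x) ∧
      ∀ g : W, ‖M (S g)‖ ≤ Kw / (1 - Kw * ε) * ‖g‖ := by
  -- the finite-rank corrected operator `D = 1 − S Π_N` and its two-sided inverse `T`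
  set v : ι → E := fun i => S (f i) with hv
  set D : E →L[ℝ] E := 1 - finiteRank v ℓ with hD
  set T : E →L[ℝ] E := capInverse v ℓ N with hT
  have hDT : ∀ y, D (T y) = y := fun y => by
    have h := congrArg (fun A : E →L[ℝ] E => A y) (one_sub_finiteRank_comp_capInverse v ℓ N hN₁)
    simpa [hD, hT] using h
  have hTD : ∀ u, T (D u) = u := fun u => by
    have h := congrArg (fun A : E →L[ℝ] E => A u) (capInverse_comp_one_sub_finiteRank v ℓ N hN₂)
    simpa [hD, hT] using h
  -- the remainder `Π_T = P − Π_N` as an operator `E →L W`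
  set PiT : E →L[ℝ] W := P - ∑ i, (ℓ i).smulRight (f i) with hPiT
  have hPiT_apply : ∀ u, PiT u = P u - ∑ i, ℓ i u • f i := fun u => by
    simp [hPiT, ContinuousLinearMap.smulRight_apply]
  -- `(1 − S P) u = D u − S (Π_T u)`
  have hsplit : ∀ u, u - S (P u) = D u - S (PiT u) := fun u => by
    rw [hPiT_apply, map_sub, map_sum_smul_eq_finiteRank, hD]
    simp only [_root_.sub_apply, one_apply_eq_self]
    abel
  -- the small operator `X = T S Π_T`, `‖X‖ ≤ K_w ε < 1`
  set X : E →L[ℝ] E := T.comp (S.comp PiT) with hX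
  have hXle : ‖X‖ ≤ Kw * ε := by
    refine ContinuousLinearMap.opNorm_le_bound _ (mul_nonneg hKw0 hε0) fun u => ?_
    calc ‖X u‖ = ‖T (S (PiT u))‖ := rfl
      _ ≤ Kw * ‖PiT u‖ := hKw _
      _ ≤ Kw * (ε * ‖u‖) := mul_le_mul_of_nonneg_left (by rw [hPiT_apply]; exact hε u) hKw0
      _ = Kw * ε * ‖u‖ := by ring
  have hX1 : ‖X‖ < 1 := lt_of_le_of_lt hXle h1
  set U : (E →L[ℝ] E)ˣ := Units.oneSub X hX1 with hU
  have hUval : ∀ z, (U : E →L[ℝ] E) z = z - X z := fun z => by simp [hU, Units.oneSub]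
  have hUinv : ∀ z, (U : E →L[ℝ] E) ((↑U⁻¹ : E →L[ℝ] E) z) = z := fun z => by
    rw [← ContinuousLinearMap.comp_apply, ← ContinuousLinearMap.mul_def, Units.mul_inv]; rfl
  have hinvU : ∀ z, (↑U⁻¹ : E →L[ℝ] E) ((U : E →L[ℝ] E) z) = z := fun z => by
    rw [← ContinuousLinearMap.comp_apply, ← ContinuousLinearMap.mul_def, Units.inv_mul]; rfl
  -- factorisation `(1 − S P) = D ∘ U`
  have hfac : ∀ u, u - S (P u) = D ((U : E →L[ℝ] E) u) := fun u => by
    rw [hsplit, hUval, map_sub]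
    show D u - S (PiT u) = D u - D (X u)
    rw [hX, ContinuousLinearMap.comp_apply, ContinuousLinearMap.comp_apply, hDT]
  refine ⟨(↑U⁻¹ : E →L[ℝ] E).comp T, fun x => ?_, fun x => ?_, fun g => ?_⟩
  · -- right inverse: `M x − S P (M x) = D (U (U⁻¹ (T x))) = D (T x) = x`
    rw [ContinuousLinearMap.comp_apply, hfac, hUinv, hDT]
  · -- left inverse: `M (x − S P x) = U⁻¹ (T (D (U x))) = x`
    rw [ContinuousLinearMap.comp_apply, hfac, hTD, hinvU]
  · have hpos : 0 < 1 - Kw * ε := by linarith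
    have hpos' : 0 < 1 - ‖X‖ := by linarith
    have hKg : 0 ≤ Kw * ‖g‖ := mul_nonneg hKw0 (norm_nonneg _)
    calc ‖((↑U⁻¹ : E →L[ℝ] E).comp T) (S g)‖ = ‖(↑U⁻¹ : E →L[ℝ] E) (T (S g))‖ := rfl
      _ ≤ ‖(↑U⁻¹ : E →L[ℝ] E)‖ * ‖T (S g)‖ := ContinuousLinearMap.le_opNorm _ _
      _ ≤ (1 - ‖X‖)⁻¹ * (Kw * ‖g‖) := mul_le_mul (norm_inv_oneSub_le hX1) (hKw g) (norm_nonneg _) (inv_nonneg.2 hpos'.le)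
      _ ≤ (1 - Kw * ε)⁻¹ * (Kw * ‖g‖) := mul_le_mul_of_nonneg_right (inv_anti₀ hpos (by linarith)) hKg
      _ = Kw / (1 - Kw * ε) * ‖g‖ := by ring

end Literature.Analysis.OperatorTheory

end
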